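/-
Copyright: statement-level skeleton of a published paper (lit-balaban cell, Phase-2 proof seat p10, gen 4). No proof claims
beyond what the kernel checks below.
-/
import Mathlib
import Literature.MathematicalPhysics.QuantumFieldTheory.BalabanImbrieJaffe1984to88.BIJ85Eq7113DerivationPart5
import Literature.MathematicalPhysics.QuantumFieldTheory.BalabanImbrieJaffe1984to88.BIJ85Eq7112FibreEnergy

/-!
# `BalabanImbrieJaffe1984to88.BIJ85Eq7113DerivationPart6` — T. Bałaban, J. Imbrie, A. Jaffe, *Renormalization of the Higgs model:
minimizers, propagators and the stability of mean field theory*, Commun. Math. Phys. **97** (1985) 299–329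
[BalabanImbrieJaffe1985]: Sect. 7.1 pp. 321–324 — **the hypothesis `hfib` of p27's configuration-space assembly
`BIJ85Eq7112FibreEnergy.thm711_config_of_fibre`, DISCHARGED for two-forms**: the dictionary between pub-balaban's offsets
k : Fin d → Fin n with the [6I] symbols (`B5Prop11Fiber.dSym/vSym/uSym`, `B5Block118.om`, p27's `edgeW`) and r15's shifts
|m_i| ≤ M (`lShifts`) with the closed-cube symbols of this seat (n = 2M + 1), and the bound at every dual momentum q : Tor N

statement-level skeleton of published theorems with citation tags; proofs where landed; nothing here is a claim about
the Yang–Mills mass gap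

CITATION HEADER (lean-in-tree rule).  Part of the lit-balaban TYPED SKELETON (HOME `run/shared/lean/pub/lit-balaban/`); WHAT IS
REPRODUCED: the JOIN between the two halves of SKELETON row **C1.Thm7.1.1** (`HOME/lit-balaban-r15/ROWS-C1.md`, fold owner r15,
referee ref-5): p27's configuration-space side (`BIJ85Eq7112FibreEnergy`: ‖∂A − Q^{e*}_kf‖²_η = Σ_q fibreEnergy q, Q_kA = 0 ⟺
∀ q FibreConstraint q, and `thm711_config_of_fibre (hfib : ∀ q φ α, FibreConstraint → c₀Σ|φ|² ≤ fibreEnergy)`) and this seat's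
momentum side (`BIJ85Eq7113DerivationPart5.thm711_energyC`: c(d)‖f‖² ≤ ‖∂A − Q^{e*}_kf‖² at every momentum of the closed cube).
Kind «reindexing + dictionary».
WHAT IS PROVED (zero `sorry`, standard axioms; n = 2M + 1 throughout, i.e. r15's symmetric shift range |m_i| ≤ M is a complete
residue system mod n — the block size L^k ODD).  §1 the closed-cube symbols z, v, ∂ (η = 1/n) are 2πn-periodic in each q_μ.
§2 the residue map `resE : (Fin d → ℤ) → (Fin d → Fin n)` and the symmetric representative `resR` are inverse bijections between
`lShifts d M` and the offsets (`resR_mem`, `resE_resR`, `resR_resE`), so **Σ_{k : Fin d → Fin n} F k = Σ_{m ∈ lShifts d M} F (resE m)**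
(`sum_offsets_eq_sum_lShifts`), and p′ + 2πm = shiftr n (resE m) p′ + 2πn·(m div n) (`shiftMom_eq_shiftr_add`).  §3 DICTIONARY at
the offset resE m: `B5Prop11Fiber.vSym = vC`, `uSym = uC`, `dSym = dSym (1/n)` at p′ + 2πm (`vSym6I_eq_vC`, `uSym6I_eq_uC`,
`dSym6I_eq_dSym`, via this seat's `vC_eq_6I`/`dSym_eq_6I` + periodicity), `B5Block118.om = zC` (`om_eq_zC`) and **p27's edge weight
`edgeW n (resE m) (sOf N q) μ ν = wC n (sOf N q) m μ ν`** for μ ≠ ν (`edgeW_eq_wC`, from p27's `edgeW_eq`).  §4 **`fibreConstraint_iff`**: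
FibreConstraint n N q α ⟺ ∀ ν, qOpC n M (sOf N q) (α ∘ resE) ν = 0; **`fibreEnergy_eq`**: for antisymmetric φ, fibreEnergy n N q α φ
= 2·energyC n M (sOf N q) (α ∘ resE) φ (ordered pairs vs the ½ of the pairing (2.20); the diagonal terms vanish on both sides);
**`hfib_twoForm`: ∀ q : Tor N, ∀ antisymmetric φ, ∀ α with FibreConstraint, 2c(d)·Σ_a|φ_a|² ≤ fibreEnergy (2M+1) N q α φ** (0 < d) —
p27's `hfib` on two-forms, by `thm711_energyC` and `abs_sOf_le`.
NOT CLAIMED: `hfib` for φ with a non-zero symmetric part (false as stated for such φ is not asserted either; σ_k only sees two-forms —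
p27 restricts the assembly); even block sizes n (r15's `lShifts` is symmetric); the identification of the minimum with ⟨f,σ_kf⟩ at
non-generic fibres.  Unit `lit-balaban-p10` (gen 4), HOME as above.
-/

namespace Literature.MathematicalPhysics.QuantumFieldTheory.BalabanImbrieJaffe1984to88.BIJ85Eq7113DerivationPart6

open scoped BigOperators Real ComplexConjugate
open Complex Finset
open Literature.MathematicalPhysics.QuantumFieldTheory.BalabanImbrieJaffe1984to88.BIJ85MomentumSymbols71
open Literature.MathematicalPhysics.QuantumFieldTheory.BalabanImbrieJaffe1984to88.BIJ85CurlComplement719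
open Literature.MathematicalPhysics.QuantumFieldTheory.BalabanImbrieJaffe1984to88.BIJ85Thm711Fibrewise
open Literature.MathematicalPhysics.QuantumFieldTheory.BalabanImbrieJaffe1984to88.BIJ85SigmaClosedCube
open Literature.MathematicalPhysics.QuantumFieldTheory.BalabanImbrieJaffe1984to88.BIJ85SigmaClosedCubeZero
open Literature.MathematicalPhysics.QuantumFieldTheory.BalabanImbrieJaffe1984to88.BIJ85MomentumSymbols6I
open Literature.MathematicalPhysics.QuantumFieldTheory.BalabanImbrieJaffe1984to88.BIJ85Eq7113Derivation
open Literature.MathematicalPhysics.QuantumFieldTheory.BalabanImbrieJaffe1984to88.BIJ85Eq7113DerivationPart5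
open Literature.MathematicalPhysics.QuantumFieldTheory.BalabanImbrieJaffe1984to88.BIJ85Eq7111EdgeAverage
open Literature.MathematicalPhysics.QuantumFieldTheory.BalabanImbrieJaffe1984to88.BIJ85Eq7112FibreEnergy
open Literature.MathematicalPhysics.QuantumFieldTheory.Balaban1983to89
open Literature.MathematicalPhysics.QuantumFieldTheory.Balaban1983to89.B5Prop11Plancherel

noncomputable section

variable {d : ℕ}

/-! ## §1 Periodicity of the closed-cube symbols under l ↦ l + 2πn·j -/

section Periodic

variable {n : ℕ}

/-- kernel: z_μ is 2πn-periodic in q_μ. [folklore] -/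
private theorem zC_add_period (hn : 0 < n) (q : Fin d → ℝ) (j : Fin d → ℤ) (μ : Fin d) :
    zC n (fun i => q i + 2 * π * n * (j i : ℝ)) μ = zC n q μ := by
  have hn' : (n : ℝ) ≠ 0 := by exact_mod_cast hn.ne'
  have hr : (n : ℝ)⁻¹ * (q μ + 2 * π * n * (j μ : ℝ)) = (n : ℝ)⁻¹ * q μ + (j μ : ℝ) * (2 * π) := by
    field_simp
  unfold zC
  show Complex.exp (Complex.I * (((n : ℝ)⁻¹ * (q μ + 2 * π * n * (j μ : ℝ)) : ℝ) : ℂ)) =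
    Complex.exp (Complex.I * (((n : ℝ)⁻¹ * q μ : ℝ) : ℂ))
  rw [hr, Complex.ofReal_add, mul_add, Complex.exp_add,
    show Complex.I * (((j μ : ℝ) * (2 * π) : ℝ) : ℂ) = ((j μ : ℤ) : ℂ) * (2 * π * Complex.I) by push_cast; ring,
    Complex.exp_int_mul_two_pi_mul_I, mul_one]

/-- kernel: v_μ is 2πn-periodic in q_μ. [folklore] -/
private theorem vC_add_period (hn : 0 < n) (q : Fin d → ℝ) (j : Fin d → ℤ) (μ : Fin d) :
    vC n (fun i => q i + 2 * π * n * (j i : ℝ)) μ = vC n q μ := by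
  unfold vC
  simp_rw [zC_add_period hn q j μ]

/-- kernel: ∂_μ (η = 1/n) is 2πn-periodic in q_μ. [folklore] -/
private theorem dSym_add_period (hn : 0 < n) (q : Fin d → ℝ) (j : Fin d → ℤ) (μ : Fin d) :
    dSym ((n : ℝ)⁻¹) (fun i => q i + 2 * π * n * (j i : ℝ)) μ = dSym ((n : ℝ)⁻¹) q μ := by
  have hn' : ((n : ℂ))⁻¹ ≠ 0 := inv_ne_zero (by exact_mod_cast hn.ne')
  have h1 := zC_sub_one hn (fun i => q i + 2 * π * n * (j i : ℝ)) μ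
  have h2 := zC_sub_one hn q μ
  rw [zC_add_period hn q j μ] at h1
  exact mul_left_cancel₀ hn' (h1.symm.trans h2)

end Periodic

/-! ## §2 The complete residue system |m_i| ≤ M versus Fin n, n = 2M + 1 -/

section Reindex

variable (M : ℕ)

/-- The residue map m ↦ (m_i mod n)_i from r15's shift set `lShifts d M` to the offsets `Fin d → Fin n` of [6I]/pub-balaban
(n = 2M + 1). [cite: BalabanImbrieJaffe1985, (7.1.10) p.322] -/
def resE (m : Fin d → ℤ) : Fin d → Fin (2 * M + 1) := fun i =>
  ⟨((m i) % (2 * M + 1 : ℕ)).toNat, by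
    have h1 : (0 : ℤ) ≤ m i % (2 * M + 1 : ℕ) := Int.emod_nonneg _ (by omega)
    have h2 : m i % (2 * M + 1 : ℕ) < (2 * M + 1 : ℕ) := Int.emod_lt_of_pos _ (by omega)
    omega⟩

/-- The symmetric representative k ↦ (k_i or k_i − n)_i ∈ [−M, M] of an offset. [cite: BalabanImbrieJaffe1985, (7.1.10) p.322] -/
def resR (k : Fin d → Fin (2 * M + 1)) : Fin d → ℤ := fun i =>
  if (k i : ℕ) ≤ M then ((k i : ℕ) : ℤ) else ((k i : ℕ) : ℤ) - (2 * M + 1 : ℕ)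

/-- kernel: a mod n = a + n for −n ≤ a < 0. [folklore] -/
private theorem emod_eq_add_of_neg {a : ℤ} {n : ℕ} (h0 : a < 0) (h1 : -((n : ℕ) : ℤ) ≤ a) : a % (n : ℤ) = a + n := by
  calc a % (n : ℤ) = (a + n * 1) % n := (Int.add_mul_emod_self_left a n 1).symm
    _ = a + n := by rw [mul_one]; exact Int.emod_eq_of_lt (by omega) (by omega)

/-- kernel: the residue of m_i as an integer. [folklore] -/
private theorem resE_val (m : Fin d → ℤ) (i : Fin d) : ((resE M m i : ℕ) : ℤ) = m i % (2 * M + 1 : ℕ) := by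
  rw [resE, Fin.val_mk, Int.toNat_of_nonneg (Int.emod_nonneg _ (by omega))]

/-- kernel: the representative lies in the symmetric range. [folklore] -/
private theorem resR_mem (k : Fin d → Fin (2 * M + 1)) : resR M k ∈ lShifts d M := by
  simp only [lShifts, Fintype.mem_piFinset, Finset.mem_Icc]
  intro i
  have hk : (k i : ℕ) < 2 * M + 1 := (k i).isLt
  unfold resR
  split_ifs with h
  · constructor <;> omega
  · push_cast
    constructor <;> omega

/-- kernel: E ∘ R = id. [folklore] -/
private theorem resE_resR (k : Fin d → Fin (2 * M + 1)) : resE M (resR M k) = k := by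
  funext i
  apply Fin.ext
  have hk : (k i : ℕ) < 2 * M + 1 := (k i).isLt
  have h := resE_val M (resR M k) i
  have hval : resR M k i % ((2 * M + 1 : ℕ) : ℤ) = ((k i : ℕ) : ℤ) := by
    unfold resR
    split_ifs with hle
    · exact Int.emod_eq_of_lt (by omega) (by omega)
    · have hneg : ((k i : ℕ) : ℤ) - ((2 * M + 1 : ℕ) : ℤ) < 0 := by omega
      rw [emod_eq_add_of_neg hneg (by omega)]
      ring
  rw [hval] at h
  exact_mod_cast h

/-- kernel: R ∘ E = id on the symmetric range. [folklore] -/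
private theorem resR_resE {m : Fin d → ℤ} (hm : m ∈ lShifts d M) : resR M (resE M m) = m := by
  simp only [lShifts, Fintype.mem_piFinset, Finset.mem_Icc] at hm
  funext i
  obtain ⟨h1, h2⟩ := hm i
  have hv : ((resE M m i : ℕ) : ℤ) = m i % ((2 * M + 1 : ℕ) : ℤ) := resE_val M m i
  unfold resR
  by_cases hnn : 0 ≤ m i
  · have he : m i % ((2 * M + 1 : ℕ) : ℤ) = m i := Int.emod_eq_of_lt hnn (by omega)
    rw [he] at hv
    have hle : (resE M m i : ℕ) ≤ M := by omega
    rw [if_pos hle]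
    exact hv
  · have he : m i % ((2 * M + 1 : ℕ) : ℤ) = m i + ((2 * M + 1 : ℕ) : ℤ) := emod_eq_add_of_neg (by omega) (by omega)
    rw [he] at hv
    have hgt : ¬ (resE M m i : ℕ) ≤ M := by omega
    rw [if_neg hgt]
    omega

/-- **Σ over the offsets Fin d → Fin n = Σ over r15's shifts |m_i| ≤ M** (n = 2M + 1), through the residue map.
[cite: BalabanImbrieJaffe1985, (7.1.10) p.322] -/
theorem sum_offsets_eq_sum_lShifts {β : Type*} [AddCommMonoid β] (F : (Fin d → Fin (2 * M + 1)) → β) :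
    ∑ k, F k = ∑ m ∈ lShifts d M, F (resE M m) := by
  exact Finset.sum_nbij' (resR M) (resE M) (fun k _ => resR_mem M k) (fun m _ => Finset.mem_univ _)
    (fun k _ => resE_resR M k) (fun m hm => resR_resE M hm) (fun k _ => by rw [resE_resR])

/-- kernel: p′ + 2πm = (p′ + 2π·res(m)) + 2πn·(m div n) coordinatewise. [folklore] -/
private theorem shiftMom_eq_shiftr_add (p : Fin d → ℝ) (m : Fin d → ℤ) :
    shiftMom p m = fun i => B4Strip.shiftr (2 * M + 1) (resE M m) p i +
      2 * π * ((2 * M + 1 : ℕ) : ℝ) * ((m i / (2 * M + 1 : ℕ) : ℤ) : ℝ) := by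
  funext i
  have hdiv : m i = m i % (2 * M + 1 : ℕ) + (2 * M + 1 : ℕ) * (m i / (2 * M + 1 : ℕ)) := by
    have := Int.emod_add_ediv_mul (m i) ((2 * M + 1 : ℕ) : ℤ)
    linarith
  have hv : ((resE M m i : ℕ) : ℤ) = m i % (2 * M + 1 : ℕ) := resE_val M m i
  simp only [shiftMom, B4Strip.shiftr]
  have : (m i : ℝ) = ((resE M m i : ℕ) : ℝ) + ((2 * M + 1 : ℕ) : ℝ) * ((m i / (2 * M + 1 : ℕ) : ℤ) : ℝ) := by
    have h := congrArg (fun z : ℤ => (z : ℝ)) hdiv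
    simp only [Int.cast_add, Int.cast_mul, Int.cast_natCast] at h
    rw [h, ← hv, Int.cast_natCast]
  rw [this]
  ring

end Reindex

/-! ## §3 The [6I]/pub-balaban symbols at the offset res(m) are the closed-cube symbols at the shift m -/

section Dictionary

variable (M : ℕ)

/-- `B5Prop11Fiber.vSym n (res m) p′ μ = vC n (p′ + 2πm) μ` (n = 2M + 1). [cite: BalabanImbrieJaffe1985, (7.1.7) p.322] -/
theorem vSym6I_eq_vC (p : Fin d → ℝ) (m : Fin d → ℤ) (μ : Fin d) :
    B5Prop11Fiber.vSym (2 * M + 1) (resE M m) p μ = vC (2 * M + 1) (shiftMom p m) μ := by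
  rw [← vC_eq_6I (by omega) (resE M m) p μ, shiftMom_eq_shiftr_add M p m]
  exact (vC_add_period (by omega) _ _ μ).symm

/-- `B5Prop11Fiber.uSym n (res m) p′ = uC n (p′ + 2πm)`. [cite: BalabanImbrieJaffe1985, (7.1.9) p.322] -/
theorem uSym6I_eq_uC (p : Fin d → ℝ) (m : Fin d → ℤ) :
    B5Prop11Fiber.uSym (2 * M + 1) (resE M m) p = uC (2 * M + 1) (shiftMom p m) := by
  rw [B5Prop11Fiber.uSym, uC]
  exact Finset.prod_congr rfl fun μ _ => vSym6I_eq_vC M p m μ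

/-- `B5Prop11Fiber.dSym n (res m) p′ μ = ∂_μ(p′ + 2πm)` at η = 1/n. [cite: BalabanImbrieJaffe1985, (7.1.4) p.322] -/
theorem dSym6I_eq_dSym (p : Fin d → ℝ) (m : Fin d → ℤ) (μ : Fin d) :
    B5Prop11Fiber.dSym (2 * M + 1) (resE M m) p μ = dSym (((2 * M + 1 : ℕ) : ℝ)⁻¹) (shiftMom p m) μ := by
  rw [← dSym_eq_6I (by omega) (resE M m) p μ, one_div, shiftMom_eq_shiftr_add M p m]
  exact (dSym_add_period (by omega) _ _ μ).symm

/-- `B5Block118.om n (res m) p′ ρ = z_ρ(p′ + 2πm)`. [cite: BalabanImbrieJaffe1985, (7.1.4) p.322] -/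
theorem om_eq_zC (p : Fin d → ℝ) (m : Fin d → ℤ) (ρ : Fin d) :
    B5Block118.om (2 * M + 1) (resE M m) p ρ = zC (2 * M + 1) (shiftMom p m) ρ := by
  rw [shiftMom_eq_shiftr_add M p m, zC_add_period (by omega)]
  rw [B5Block118.om, zC]
  congr 1
  push_cast
  ring

/-- **p27's configuration-space edge weight at the offset res(m) is the closed-cube edge weight `wC` at the shift m** (μ ≠ ν).
[cite: BalabanImbrieJaffe1985, (7.1.11) p.322] -/
theorem edgeW_eq_wC {N : Fin d → ℕ} (q : Tor N) (m : Fin d → ℤ) {μ ν : Fin d} (hμν : μ ≠ ν) :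
    edgeW (2 * M + 1) (resE M m) (sOf N q) μ ν = wC (2 * M + 1) (sOf N q) m μ ν := by
  rw [edgeW_eq (2 * M + 1) N (resE M m) q hμν, wC, qeW, om_eq_zC, om_eq_zC]
  congr 1
  exact Finset.prod_congr rfl fun ρ _ => vSym6I_eq_vC M (sOf N q) m ρ

end Dictionary

/-! ## §4 p27's fibre energy and constraint = the closed-cube energy and constraint; the bound `hfib` for two-forms -/

section FibreBound

variable (M : ℕ) {N : Fin d → ℕ}

/-- **The fibre constraint of `BIJ85Eq7112FibreEnergy` is the closed-cube constraint of file 5** (reindexed).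
[cite: BalabanImbrieJaffe1985, (4.2.1) p.310] -/
theorem fibreConstraint_iff (q : Tor N) (α : (Fin d → Fin (2 * M + 1)) → Fin d → ℂ) :
    FibreConstraint (2 * M + 1) N q α ↔ ∀ ν, qOpC (2 * M + 1) M (sOf N q) (fun m => α (resE M m)) ν = 0 := by
  refine forall_congr' fun ν => ?_
  rw [sum_offsets_eq_sum_lShifts M, qOpC]
  refine Eq.congr (Finset.sum_congr rfl fun m _ => ?_) rfl
  rw [rC, uSym6I_eq_uC, vSym6I_eq_vC]

/-- **The fibre energy of `BIJ85Eq7112FibreEnergy` is twice the closed-cube energy of file 5** (ordered pairs vs the ½ of the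
plaquette pairing (2.20)), for two-forms φ (reindexed). [cite: BalabanImbrieJaffe1985, (4.2.1) p.310] -/
theorem fibreEnergy_eq (q : Tor N) (α : (Fin d → Fin (2 * M + 1)) → Fin d → ℂ) {φ : Fin d × Fin d → ℂ}
    (hφ : ∀ μ ν, φ (ν, μ) = -φ (μ, ν)) :
    fibreEnergy (2 * M + 1) N q α φ =
      2 * energyC (2 * M + 1) M (sOf N q) (fun m => α (resE M m)) (fun μ ν => φ (μ, ν)) := by
  rw [fibreEnergy, sum_offsets_eq_sum_lShifts M, energyC, pNormSq, ← mul_assoc, show (2 : ℝ) * (1 / 2) = 1 by norm_num,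
    one_mul]
  refine Finset.sum_congr rfl fun m _ => ?_
  rw [Fintype.sum_prod_type]
  refine Finset.sum_congr rfl fun μ _ => Finset.sum_congr rfl fun ν _ => ?_
  by_cases hμν : μ = ν
  · subst hμν
    have h0 : φ (μ, μ) = 0 := by
      have := hφ μ μ
      linear_combination (1 / 2 : ℂ) * this
    simp [curlF, qeStarC, h0]
  · rw [dSym6I_eq_dSym, dSym6I_eq_dSym, edgeW_eq_wC M q m hμν]
    rfl

/-- **`hfib` for two-forms, every dual momentum**: for every q : Tor N (generic, axis or zero), every antisymmetric φ and every
constrained α, 2c(d)·Σ_a|φ_a|² ≤ fibreEnergy — the hypothesis of p27's `BIJ85Eq7112FibreEnergy.thm711_config_of_fibre`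
restricted to two-forms (σ_k only ever sees two-forms), discharged by file 5's `thm711_energyC` (n = 2M + 1, i.e. L odd).
[cite: BalabanImbrieJaffe1985, Prop. 7.1.2 (7.1.22) p.324] -/
theorem hfib_twoForm [∀ μ, NeZero (N μ)] (hd : 0 < d) (q : Tor N) {φ : Fin d × Fin d → ℂ}
    (hφ : ∀ μ ν, φ (ν, μ) = -φ (μ, ν)) (α : (Fin d → Fin (2 * M + 1)) → Fin d → ℂ)
    (hα : FibreConstraint (2 * M + 1) N q α) :
    2 * c711 d * ∑ a, ‖φ a‖ ^ 2 ≤ fibreEnergy (2 * M + 1) N q α φ := by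
  have hs : ∀ i, |sOf N q i| ≤ π := fun i => abs_sOf_le N q i
  have hA := (fibreConstraint_iff M q α).mp hα
  have hf : IsTwoForm (fun μ ν => φ (μ, ν)) := fun μ ν => hφ μ ν
  have h := thm711_energyC hd ⟨2 * M + 1, M, le_rfl⟩ hs hf hA
  rw [fibreEnergy_eq M q α hφ, Fintype.sum_prod_type]
  unfold BIJ85CurlComplement719.normSq at h
  linarith

end FibreBound

end

end Literature.MathematicalPhysics.QuantumFieldTheory.BalabanImbrieJaffe1984to88.BIJ85Eq7113DerivationPart6
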